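import Literature.NumberTheory.LFunctions.FordLargeLambdaCheck
import HarnessLib

/-!
# The tail `λ ≥ 2025` of Ford's Theorem 2: a three-variable box certificate and its reduction

Topic `Literature/NumberTheory/LFunctions`. Everything here is PROVED; no named fact is introduced
(the `def`s are a checker: an expression language in three interval variables, its interval
evaluator, the cells of a box and their Boolean check).

For `λ = log t/log N ≥ Λ₀ = 2025` the side conditions of `FordVK.sec5_interval`
(`FordLargeLambdaCore.lean`) cannot be listed row by row. Ford [Ford2002, Lemma 5.2] handles large
`λ` analytically with `f(γ,φ)`; here we follow the same reduction but close the final numerical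
inequality by a kernel-checked *box* computation, which is sharper and avoids the hand constants of
(5.25)–(5.31). With Ford's choices `k = ⌊λ/κ + 3·10⁻⁶⌋`, `h = ⌊γ₀λ + ½⌋`,
`g = ⌊(γ₀ + δ₀)λ + ½⌋`, `s = ⌊σ h(g−h)⌋ + 1`, `m_i = ⌊λ/(1−μ_i)⌋` and `η ≤ (2/16.3)λ^{-3/2}`, and the
variables `u = h/λ`, `d = (g−h)/λ`, `w = λ^{-1/2}`, the exponent condition `c9` multiplied by `λ²` is
bounded by `10⁻⁷ + n(u,d,w)/den(u,d,w) + 1/133.66` (`Tail.c9_reduction`), where `n`, `den` are the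
explicit closed forms `Tail.nf`, `Tail.denf` (the sums `Z₀ + Z₁λ` of (5.11)–(5.12) are evaluated in
closed form, `Tail.sum_closed_form`, up to a term `B ∈ [0, 0.20615]` coming from the fractional parts
of `λ/(1−μ_i)`). The point `(u, d, w)` lies in the box
`[γ₀ ∓ 1/4050] × [δ₀ ∓ 1/2025] × [0, 1/45]`, which is covered by `16 × 16 × 50` cells
(`Tail.uLo/uHi/dLo/dHi/wgrid`); on each cell the kernel evaluates `n` and `n/den` by outward-rounded
interval arithmetic (`BExpr.encl` over `Literature.Analysis.ValidatedNumerics.NumericsMP.MI`,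
soundness `BExpr.mem_encl`) and checks `n < 0`, `n/den + 10⁻⁷ + 1/133.66 ≤ 0` (`Tail.checkCell`,
soundness `Tail.checkCell_sound`). `Tail.checkAll` is the conjunction over all cells; its kernel
evaluation and the remaining (analytic) side conditions are in `FordLargeLambdaTailCells*.lean` and
`FordLargeLambdaTail.lean`.

Constants: `γ₀ = 1.1818`, `δ₀ = 0.0635` [Ford2002, (5.24)], `κ = 0.6492 = 1623/2500`,
`ρ = 3.21432`, `θ = 2.3291`, `σ = 0.3299`, `μ₁ = 0.1905`, `μ₂ = 0.1603` [Ford2002, (5.13), (5.16)].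

## References
* K. Ford, Proc. London Math. Soc. (3) 85 (2002), 565–633; arXiv:1910.08209: §5, (5.11)–(5.12),
  (5.18)–(5.24), Lemma 5.2. [Ford2002]
* R. E. Moore, *Interval Analysis* (1966) (inclusion property), via
  `Literature/Analysis/ValidatedNumerics/MultiPrecisionInterval.lean`. [folklore]
-/

open Finset Real

namespace Literature.NumberTheory.LFunctions
namespace FordVK

open Literature.Analysis.ValidatedNumerics Literature.Analysis.ValidatedNumerics.NumericsMP

/-- Expressions in three real variables `u, d, w` and rational constants. [folklore] -/
inductive BExpr where
  | frac (p : ℤ) (q : ℕ) : BExpr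
  | varU : BExpr
  | varD : BExpr
  | varW : BExpr
  | add (a b : BExpr) : BExpr
  | sub (a b : BExpr) : BExpr
  | mul (a b : BExpr) : BExpr
  | div (a b : BExpr) : BExpr
  | neg (a : BExpr) : BExpr
  | sqr (a : BExpr) : BExpr
  | exp (a : BExpr) : BExpr
  deriving Repr

namespace BExpr

/-- The value at a point. [folklore] -/
noncomputable def val (u d w : ℝ) : BExpr → ℝ
  | frac p q => (p : ℝ) / q
  | varU => u
  | varD => d
  | varW => w
  | add a b => val u d w a + val u d w b
  | sub a b => val u d w a - val u d w b
  | mul a b => val u d w a * val u d w b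
  | div a b => val u d w a / val u d w b
  | neg a => -val u d w a
  | sqr a => val u d w a ^ 2
  | exp a => Real.exp (val u d w a)

/-- The interval evaluator on a box `U × D × W`. [folklore] -/
def encl (S K kr : ℕ) (U D W : MI) : BExpr → Option MI
  | frac p q => if q = 0 then none else some (MI.ofFrac S p q)
  | varU => some U
  | varD => some D
  | varW => some W
  | add a b =>
    match encl S K kr U D W a, encl S K kr U D W b with
    | some A, some B => some (A.add B)
    | _, _ => none
  | sub a b =>
    match encl S K kr U D W a, encl S K kr U D W b with
    | some A, some B => some (A.sub B)
    | _, _ => none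
  | mul a b =>
    match encl S K kr U D W a, encl S K kr U D W b with
    | some A, some B => some (MI.mul S A B)
    | _, _ => none
  | div a b =>
    match encl S K kr U D W a, encl S K kr U D W b with
    | some A, some B => MI.divPos S A B
    | _, _ => none
  | neg a =>
    match encl S K kr U D W a with
    | some A => some A.neg
    | none => none
  | sqr a =>
    match encl S K kr U D W a with
    | some A => some (MI.sqr S A)
    | none => none
  | exp a =>
    match encl S K kr U D W a with
    | some A => MI.exp S K kr A
    | none => none

/-- **Soundness of the box evaluator.** [folklore] -/
theorem mem_encl {S K kr : ℕ} (hS : 0 < S) {U D W : MI} {u d w : ℝ} (hu : MI.mem S u U)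
    (hd : MI.mem S d D) (hw : MI.mem S w W) :
    ∀ (e : BExpr) {Y : MI}, encl S K kr U D W e = some Y → MI.mem S (val u d w e) Y
  | frac p q, Y, h => by
    simp only [encl] at h
    split_ifs at h with hq
    simp only [Option.some.injEq] at h
    subst h
    exact MI.mem_ofFrac S p (Nat.pos_of_ne_zero hq)
  | varU, Y, h => by simp only [encl, Option.some.injEq] at h; subst h; exact hu
  | varD, Y, h => by simp only [encl, Option.some.injEq] at h; subst h; exact hd
  | varW, Y, h => by simp only [encl, Option.some.injEq] at h; subst h; exact hw
  | add a b, Y, h => by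
    simp only [encl] at h
    split at h
    · rename_i A B hA hB
      simp only [Option.some.injEq] at h
      subst h
      exact MI.mem_add (mem_encl hS hu hd hw a hA) (mem_encl hS hu hd hw b hB)
    · simp at h
  | sub a b, Y, h => by
    simp only [encl] at h
    split at h
    · rename_i A B hA hB
      simp only [Option.some.injEq] at h
      subst h
      exact MI.mem_sub (mem_encl hS hu hd hw a hA) (mem_encl hS hu hd hw b hB)
    · simp at h
  | mul a b, Y, h => by
    simp only [encl] at h
    split at h
    · rename_i A B hA hB
      simp only [Option.some.injEq] at h
      subst h
      exact MI.mem_mul hS (mem_encl hS hu hd hw a hA) (mem_encl hS hu hd hw b hB)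
    · simp at h
  | div a b, Y, h => by
    simp only [encl] at h
    split at h
    · rename_i A B hA hB
      exact MI.mem_divPos hS h (mem_encl hS hu hd hw a hA) (mem_encl hS hu hd hw b hB)
    · simp at h
  | neg a, Y, h => by
    simp only [encl] at h
    split at h
    · rename_i A hA
      simp only [Option.some.injEq] at h
      subst h
      exact MI.mem_neg (mem_encl hS hu hd hw a hA)
    · simp at h
  | sqr a, Y, h => by
    simp only [encl] at h
    split at h
    · rename_i A hA
      simp only [Option.some.injEq] at h
      subst h
      exact MI.mem_sqr hS (mem_encl hS hu hd hw a hA)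
    · simp at h
  | exp a, Y, h => by
    simp only [encl] at h
    split at h
    · rename_i A hA
      exact MI.mem_exp hS h (mem_encl hS hu hd hw a hA)
    · simp at h

end BExpr

end FordVK
end Literature.NumberTheory.LFunctions

namespace Literature.NumberTheory.LFunctions
namespace FordVK

open Literature.Analysis.ValidatedNumerics Literature.Analysis.ValidatedNumerics.NumericsMP
open BExpr

/-! ### The tail function `F(u, d, w)` and its box certificate (`λ ≥ 2025`) -/

namespace Tail

/-- `σ = 0.3299`. [cite: Ford2002, (5.24)] -/
def eSig : BExpr := frac 3299 10000
/-- `ν = w²`. [folklore] -/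
def eNu : BExpr := sqr varW
/-- `κ⁺ = 1/c₁₂ + 3·10⁻⁶ ν` (upper bound of `k/λ`). [cite: Ford2002, (5.13), (5.23)] -/
def eKhi : BExpr := add (frac 2500 1623) (mul (frac 3 1000000) eNu)
/-- `φ = u + d`. [folklore] -/
def eP : BExpr := add varU varD
/-- `H₂(γ, φ)` in centred form. [cite: Ford2002, (5.12)] -/
def eH2 : BExpr :=
  sub (sub (frac 839364463 14709511926) (mul (sqr (sub varU (frac 1 1))) (frac 1 2)))
      (mul (frac 6492 20000) (sqr (sub eP (frac 2500 1623))))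
/-- `H₁(γ, φ)`. [cite: Ford2002, (5.12)] -/
def eH1 : BExpr := sub (mul varU (frac 1 2)) (mul (frac 6492 20000) eP)
/-- `δ⁺ = d + ν` (`τ/λ`). [folklore] -/
def eDp : BExpr := add varD eNu
/-- `q`: the upper bound of `Q/λ² = (μ₁·0.001k² + μ₂E₂)/λ²`. [cite: Ford2002, (5.18), (5.22)] -/
def eQ : BExpr :=
  add (mul (frac 1905 10000000) (sqr eKhi))
      (mul (frac 1603 10000)
        (add (add (mul (mul eDp varD) (frac 1 2))
                  (div (mul (sqr (add (mul (mul eSig varU) varD) (sqr eNu))) varW)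
                       (mul (frac 16300 1000) eDp)))
             (mul (mul varU eDp) (exp (div (neg (mul eSig varD)) eDp)))))
/-- `n = q − H₂ − νH₁ + 0.20615ν²` (the numerator, `< 0`). [cite: Ford2002, (5.22)] -/
def eN : BExpr := add (sub (sub eQ eH2) (mul eNu eH1)) (mul (frac 4123 20000) (sqr eNu))
/-- `den = 2(ρκ⁺² + ν²)(σud + ν²)` (upper bound of `2rs/λ⁴`). [cite: Ford2002, (5.21)] -/
def eDen : BExpr :=
  mul (mul (frac 2 1) (add (mul (frac 321432 100000) (sqr eKhi)) (sqr eNu)))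
      (add (mul (mul eSig varU) varD) (sqr eNu))
/-- `n/den`. [folklore] -/
def eMain : BExpr := div eN eDen

/-- The `w`-grid numerators (denominator `900000`; `w ∈ [0, 1/45]`, spacing uniform in `ν = w²`).
[folklore] -/
def wgrid : List ℕ := [0, 2828, 4000, 4899, 5657, 6325, 6928, 7483, 8000, 8485, 8944, 9381, 9798, 10198, 10583, 10954, 11314, 11662, 12000, 12329, 12649, 12961, 13266, 13565, 13856, 14142, 14422, 14697, 14967, 15232, 15492, 15748, 16000, 16248, 16492, 16733, 16971, 17205, 17436, 17664, 17889, 18111, 18330, 18547, 18762, 18974, 19183, 19391, 19596, 19799, 20000]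
/-- Denominator of the `w`-grid. [folklore] -/
def wQ : ℕ := 900000
/-- Cells in `u`. [folklore] -/
def nU : ℕ := 16
/-- Cells in `d`. [folklore] -/
def nD : ℕ := 16

/-- The `u`-cell `i`: `[γ₀ − 1/4050 + i/(16·2025), γ₀ − 1/4050 + (i+1)/(16·2025)]`, `γ₀ = 1.1818`, as
numerators over `810000` (`γ₀ = 957258/810000`, `1/4050 = 200/810000`, `1/(16·2025) = 25/810000`).
[folklore] -/
def uLo (i : ℕ) : ℤ := 957258 - 200 + 25 * i
/-- Upper numerator of the `u`-cell. [folklore] -/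
def uHi (i : ℕ) : ℤ := 957258 - 200 + 25 * (i + 1)
/-- The `d`-cell `j`: `[d₀ − 1/2025 + 2j/(16·2025), …]`, `d₀ = 0.0635 = 51435/810000`,
`1/2025 = 400/810000`, cell width `50/810000`. [folklore] -/
def dLo (j : ℕ) : ℤ := 51435 - 400 + 50 * j
/-- Upper numerator of the `d`-cell. [folklore] -/
def dHi (j : ℕ) : ℤ := 51435 - 400 + 50 * (j + 1)

/-- The interval of a cell `[a/q, b/q]` at scale `S`. [folklore] -/
def cellMI (S : ℕ) (a b : ℤ) (q : ℕ) : MI := MI.span (MI.ofFrac S a q) (MI.ofFrac S b q)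

/-- The comparison part of the cell check on already computed enclosures `N ∋ n`, `V ∋ n/den`:
`n < 0` and `n/den + 10⁻⁷ + 1/133.66 ≤ 0` (`10⁻⁷ ≥ λ²E₃/r`). [folklore] -/
def checkCellWith (N V : Option MI) : Bool :=
  match N, V with
  | some N, some V => decide (N.hi < 0
      ∧ ((V.add (MI.ofFrac Sec5Row.S5 1 10000000)).add (MI.ofFrac Sec5Row.S5 50 6683)).hi ≤ 0)
  | _, _ => false

/-- What a passed comparison means. [folklore] -/
theorem checkCellWith_true {A B : Option MI} (h : checkCellWith A B = true) :
    ∃ N V, A = some N ∧ B = some V ∧ N.hi < 0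
      ∧ ((V.add (MI.ofFrac Sec5Row.S5 1 10000000)).add (MI.ofFrac Sec5Row.S5 50 6683)).hi ≤ 0 := by
  cases A with
  | none => simp [checkCellWith] at h
  | some N =>
    cases B with
    | none => simp [checkCellWith] at h
    | some V =>
      simp only [checkCellWith, decide_eq_true_eq] at h
      exact ⟨N, V, rfl, rfl, h.1, h.2⟩

/-- The check of one cell `(i, j, l)`. [folklore] -/
def checkCell (i j l : ℕ) : Bool :=
  checkCellWith
    (encl Sec5Row.S5 Sec5Row.K5 Sec5Row.kr5 (cellMI Sec5Row.S5 (uLo i) (uHi i) 810000)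
      (cellMI Sec5Row.S5 (dLo j) (dHi j) 810000)
      (cellMI Sec5Row.S5 ((wgrid.getD l 0 : ℕ) : ℤ) ((wgrid.getD (l + 1) 0 : ℕ) : ℤ) wQ) eN)
    (encl Sec5Row.S5 Sec5Row.K5 Sec5Row.kr5 (cellMI Sec5Row.S5 (uLo i) (uHi i) 810000)
      (cellMI Sec5Row.S5 (dLo j) (dHi j) 810000)
      (cellMI Sec5Row.S5 ((wgrid.getD l 0 : ℕ) : ℤ) ((wgrid.getD (l + 1) 0 : ℕ) : ℤ) wQ) eMain)

/-- The whole box certificate. [folklore] -/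
def checkAll : Bool :=
  (List.range nU).all fun i => (List.range nD).all fun j => (List.range 50).all fun l => checkCell i j l

end Tail

end FordVK
end Literature.NumberTheory.LFunctions

namespace Literature.NumberTheory.LFunctions
namespace FordVK
namespace Tail

open Literature.Analysis.ValidatedNumerics Literature.Analysis.ValidatedNumerics.NumericsMP
open BExpr

/-! ### The real functions behind `eN`, `eDen` -/

/-- `H₂` in centred form as a function of `(u, d)` (`γ = u`, `φ = u + d`). [cite: Ford2002, (5.12)] -/
noncomputable def H2f (u d : ℝ) : ℝ :=
  839364463 / 14709511926 - (u - 1) ^ 2 * (1 / 2) - 6492 / 20000 * (u + d - 2500 / 1623) ^ 2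

/-- `H₁`. [cite: Ford2002, (5.12)] -/
noncomputable def H1f (u d : ℝ) : ℝ := u * (1 / 2) - 6492 / 20000 * (u + d)

/-- `q(u,d,w)`. [cite: Ford2002, (5.18), (5.22)] -/
noncomputable def qf (u d w : ℝ) : ℝ :=
  1905 / 10000000 * (2500 / 1623 + 3 / 1000000 * w ^ 2) ^ 2
    + 1603 / 10000 * ((d + w ^ 2) * d * (1 / 2)
      + (3299 / 10000 * u * d + (w ^ 2) ^ 2) ^ 2 * w / (16300 / 1000 * (d + w ^ 2))
      + u * (d + w ^ 2) * Real.exp (-(3299 / 10000 * d) / (d + w ^ 2)))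

/-- `n(u,d,w) = q − H₂ − νH₁ + 0.20615ν²`. [cite: Ford2002, (5.22)] -/
noncomputable def nf (u d w : ℝ) : ℝ := qf u d w - H2f u d - w ^ 2 * H1f u d + 4123 / 20000 * (w ^ 2) ^ 2

/-- `den(u,d,w) = 2(ρκ⁺² + ν²)(σud + ν²)`. [cite: Ford2002, (5.21)] -/
noncomputable def denf (u d w : ℝ) : ℝ :=
  2 * (321432 / 100000 * (2500 / 1623 + 3 / 1000000 * w ^ 2) ^ 2 + (w ^ 2) ^ 2)
    * (3299 / 10000 * u * d + (w ^ 2) ^ 2)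

/-- The value of `eN`. [folklore] -/
theorem val_eN (u d w : ℝ) : BExpr.val u d w eN = nf u d w := by
  simp only [eN, eQ, eH2, eH1, eDp, eP, eKhi, eNu, eSig, BExpr.val, nf, qf, H2f, H1f]
  push_cast
  ring

/-- The value of `eDen`. [folklore] -/
theorem val_eDen (u d w : ℝ) : BExpr.val u d w eDen = denf u d w := by
  simp only [eDen, eKhi, eNu, eSig, BExpr.val, denf]
  push_cast
  ring

/-- The value of `eMain`. [folklore] -/
theorem val_eMain (u d w : ℝ) : BExpr.val u d w eMain = nf u d w / denf u d w := by
  simp only [eMain, BExpr.val, val_eN, val_eDen]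

/-! ### Soundness of one cell -/

/-- Membership in a cell interval. [folklore] -/
theorem mem_cellMI {S : ℕ} {a b : ℤ} {q : ℕ} (hq : 0 < q) {x : ℝ}
    (h1 : (a : ℝ) / q ≤ x) (h2 : x ≤ (b : ℝ) / q) : MI.mem S x (cellMI S a b q) :=
  MI.mem_span (MI.mem_ofFrac S a hq) (MI.mem_ofFrac S b hq) h1 h2

/-- **Soundness of `checkCell`.** [folklore] -/
theorem checkCell_sound {i j l : ℕ} (hc : checkCell i j l = true) {u d w : ℝ}
    (hu1 : ((uLo i : ℤ) : ℝ) / 810000 ≤ u) (hu2 : u ≤ ((uHi i : ℤ) : ℝ) / 810000)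
    (hd1 : ((dLo j : ℤ) : ℝ) / 810000 ≤ d) (hd2 : d ≤ ((dHi j : ℤ) : ℝ) / 810000)
    (hw1 : ((wgrid.getD l 0 : ℕ) : ℝ) / wQ ≤ w) (hw2 : w ≤ ((wgrid.getD (l + 1) 0 : ℕ) : ℝ) / wQ) :
    nf u d w < 0 ∧ nf u d w / denf u d w + 1 / 10000000 + 50 / 6683 ≤ 0 := by
  have hS := Sec5Row.S5_pos
  have hQ : 0 < wQ := by unfold wQ; norm_num
  have hu := mem_cellMI (S := Sec5Row.S5) (by norm_num : 0 < 810000) hu1 hu2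
  have hd := mem_cellMI (S := Sec5Row.S5) (by norm_num) hd1 hd2
  have hw : MI.mem Sec5Row.S5 w
      (cellMI Sec5Row.S5 ((wgrid.getD l 0 : ℕ) : ℤ) ((wgrid.getD (l + 1) 0 : ℕ) : ℤ) wQ) := by
    refine mem_cellMI hQ ?_ ?_ <;> push_cast <;> assumption
  have hc' : checkCellWith
      (encl Sec5Row.S5 Sec5Row.K5 Sec5Row.kr5 (cellMI Sec5Row.S5 (uLo i) (uHi i) 810000)
        (cellMI Sec5Row.S5 (dLo j) (dHi j) 810000)
        (cellMI Sec5Row.S5 ((wgrid.getD l 0 : ℕ) : ℤ) ((wgrid.getD (l + 1) 0 : ℕ) : ℤ) wQ) eN)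
      (encl Sec5Row.S5 Sec5Row.K5 Sec5Row.kr5 (cellMI Sec5Row.S5 (uLo i) (uHi i) 810000)
        (cellMI Sec5Row.S5 (dLo j) (dHi j) 810000)
        (cellMI Sec5Row.S5 ((wgrid.getD l 0 : ℕ) : ℤ) ((wgrid.getD (l + 1) 0 : ℕ) : ℤ) wQ) eMain) = true := hc
  obtain ⟨N, V, hN, hV, hNhi, htot⟩ := checkCellWith_true hc'
  have mN := BExpr.mem_encl hS hu hd hw eN hN
  have mV := BExpr.mem_encl hS hu hd hw eMain hV
  rw [val_eN] at mN
  rw [val_eMain] at mV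
  have hSr : (0 : ℝ) < Sec5Row.S5 := by exact_mod_cast hS
  refine ⟨?_, ?_⟩
  · have h1 : nf u d w * Sec5Row.S5 ≤ N.hi := mN.2
    have h2 : (N.hi : ℝ) < 0 := by exact_mod_cast hNhi
    nlinarith
  · have msum := MI.mem_add (MI.mem_add mV (MI.mem_ofFrac Sec5Row.S5 1 (by norm_num : 0 < 10000000)))
      (MI.mem_ofFrac Sec5Row.S5 50 (by norm_num : 0 < 6683))
    have h1 := msum.2
    have h2 : ((((V.add (MI.ofFrac Sec5Row.S5 1 10000000)).add (MI.ofFrac Sec5Row.S5 50 6683)).hi : ℝ)) ≤ 0 := by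
      exact_mod_cast htot
    have h3 := h1.trans h2
    have h4 : ((50 : ℤ) : ℝ) / ((6683 : ℕ) : ℝ) = 50 / 6683 := by norm_num
    have h5 : ((1 : ℤ) : ℝ) / ((10000000 : ℕ) : ℝ) = 1 / 10000000 := by norm_num
    rw [h4, h5] at h3
    nlinarith

/-! ### The closed form of `∑ ℓ_j` and the analytic reduction of `c9` -/

/-- **`Z₀ + Z₁λ = λ²H₂ + λH₁ − B`** with `m_i = λ/(1−μ_i) − β_i`,
`B = (β₁(1−β₁)(1−μ₁) + β₂(1−β₂)(1−μ₂))/2`. [cite: Ford2002, (5.12)] -/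
theorem sum_closed_form {lam h g m₁ m₂ : ℝ} (hlam : lam ≠ 0) :
    (((m₂ - h + 1) * (h + m₂) / 2 + 0.1603 * ((m₁ - m₂) * (m₂ + 1 + m₁) / 2)
        - (1 - 0.1905 - 0.1603) * ((g - m₁) * (m₁ + 1 + g) / 2))
      + ((g - m₁) - (m₂ + 1 - h)) * lam)
    = lam ^ 2 * H2f (h / lam) ((g - h) / lam) + lam * H1f (h / lam) ((g - h) / lam)
      - (((lam / (1 - 0.1905) - m₁) * (1 - (lam / (1 - 0.1905) - m₁)) * (1 - 0.1905)
          + (lam / (1 - 0.1603) - m₂) * (1 - (lam / (1 - 0.1603) - m₂)) * (1 - 0.1603)) / 2) := by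
  unfold H2f H1f
  field_simp
  ring

/-- `0 ≤ β(1−β)c ≤ c/4` for `0 ≤ β < 1`, `c ≥ 0`. [folklore] -/
theorem beta_term_bounds {β c : ℝ} (h0 : 0 ≤ β) (h1 : β < 1) (hc : 0 ≤ c) :
    0 ≤ β * (1 - β) * c ∧ β * (1 - β) * c ≤ c / 4 := by
  constructor
  · have : 0 ≤ 1 - β := by linarith
    positivity
  · nlinarith [sq_nonneg (β - 1 / 2)]

/-- **`λ²E₃/r ≤ 10⁻⁷`** for `λ ≥ 2025`, `r ≥ 3.21432 (1.5398 λ)²`: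
`log(300λ²) ≤ 4 (300λ²)^{1/4}`. [cite: Ford2002, (5.19), (5.22)] -/
theorem E3_term_le {lam r : ℝ} (hlam : 2025 ≤ lam) (hr : 3.21432 * (1.5398 * lam) ^ 2 ≤ r) :
    lam ^ 2 * (Real.log (300 * lam ^ 2) / (300 * lam ^ 2) / r) ≤ 1 / 10000000 := by
  have hlam0 : 0 < lam := by linarith
  have hr0 : 0 < r := lt_of_lt_of_le (by positivity) hr
  have hx : (0 : ℝ) ≤ 300 * lam ^ 2 := by positivity
  have hlog : Real.log (300 * lam ^ 2) ≤ (300 * lam ^ 2) ^ ((1 : ℝ) / 4) / (1 / 4) :=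
    Real.log_le_rpow_div hx (by norm_num)
  -- `(300λ²)^{1/4} = 300^{1/4} √λ ≤ 4.17 √λ`
  set y : ℝ := (300 * lam ^ 2) ^ ((1 : ℝ) / 4) with hy
  have hy0 : 0 ≤ y := Real.rpow_nonneg hx _
  have hy4 : y ^ 4 = 300 * lam ^ 2 := by
    rw [hy, ← Real.rpow_natCast, ← Real.rpow_mul hx]; norm_num
  -- `y ≤ 4.17 √λ`: `y⁴ = 300 λ² ≤ (4.17 √λ)^4 = 4.17⁴ λ²`
  have hsq : (0 : ℝ) ≤ Real.sqrt lam := Real.sqrt_nonneg _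
  have hsq2 : Real.sqrt lam ^ 2 = lam := Real.sq_sqrt hlam0.le
  have hyle : y ≤ 4.17 * Real.sqrt lam := by
    have h4 : (4.17 * Real.sqrt lam) ^ 4 = 4.17 ^ 4 * lam ^ 2 := by
      rw [mul_pow, show (Real.sqrt lam) ^ 4 = (Real.sqrt lam ^ 2) ^ 2 by ring, hsq2]
    have : y ^ 4 ≤ (4.17 * Real.sqrt lam) ^ 4 := by rw [hy4, h4]; nlinarith
    exact le_of_pow_le_pow_left₀ (by norm_num) (by positivity) this
  have hlog' : Real.log (300 * lam ^ 2) ≤ 16.68 * Real.sqrt lam := by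
    have : y / (1 / 4) = 4 * y := by ring
    rw [this] at hlog
    linarith
  -- assemble: `λ² · log/(300 λ² r) = log/(300 r) ≤ 16.68 √λ/(300 · 3.21432 · 1.5398² λ²)`
  have e1 : lam ^ 2 * (Real.log (300 * lam ^ 2) / (300 * lam ^ 2) / r) = Real.log (300 * lam ^ 2) / (300 * r) := by
    field_simp
  rw [e1, div_le_div_iff₀ (by positivity) (by norm_num)]
  -- `log · 10⁷ ≤ 300 r`: `log ≤ 16.68 √λ`, `300 r ≥ 2286 λ² = 2286 √λ⁴`, `√λ ≥ 45`
  have hsqrt45 : (45 : ℝ) ≤ Real.sqrt lam := by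
    rw [show (45 : ℝ) = Real.sqrt (45 ^ 2) by rw [Real.sqrt_sq (by norm_num)]]
    exact Real.sqrt_le_sqrt (by nlinarith)
  have hlam_sq : lam ^ 2 = Real.sqrt lam ^ 4 := by rw [show (4 : ℕ) = 2 * 2 by rfl, pow_mul, hsq2]
  have h3 : (45 : ℝ) ^ 3 ≤ Real.sqrt lam ^ 3 := pow_le_pow_left₀ (by norm_num) hsqrt45 3
  have h4 : Real.log (300 * lam ^ 2) * 10000000 ≤ 166800000 * Real.sqrt lam := by linarith
  have h5 : 166800000 * Real.sqrt lam ≤ 2286 * Real.sqrt lam ^ 4 := by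
    have : 166800000 ≤ 2286 * Real.sqrt lam ^ 3 := by nlinarith [h3]
    nlinarith [this, hsq]
  have h6 : 2286 * Real.sqrt lam ^ 4 ≤ 1 * (300 * r) := by rw [← hlam_sq]; nlinarith [hr]
  linarith

/-- Common setup of the tail reduction: `w = λ^{-1/2}`, `u = h/λ`, `d = (g−h)/λ`. [folklore] -/
theorem tail_setup {lam h g w u d : ℝ} (hlam : 2025 ≤ lam) (hw : w = lam ^ (-(1 : ℝ) / 2))
    (hu : u = h / lam) (hd : d = (g - h) / lam) :
    w ^ 2 * lam = 1 ∧ 0 < w ∧ h = lam * u ∧ g - h = lam * d ∧ g - h + 1 = lam * (d + w ^ 2) := by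
  have hlam0 : 0 < lam := by linarith
  have hw2 : w ^ 2 = 1 / lam := by
    rw [hw, ← Real.rpow_natCast, ← Real.rpow_mul hlam0.le]; norm_num
    rw [Real.rpow_neg hlam0.le, Real.rpow_one]
  have hwlam : w ^ 2 * lam = 1 := by rw [hw2]; field_simp
  have hw0 : 0 < w := by rw [hw]; exact Real.rpow_pos_of_pos hlam0 _
  have hhlam : h = lam * u := by rw [hu]; field_simp
  have hglam : g - h = lam * d := by rw [hd]; field_simp
  have hτ : g - h + 1 = lam * (d + w ^ 2) := by rw [mul_add, ← hglam, hw2]; field_simp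
  exact ⟨hwlam, hw0, hhlam, hglam, hτ⟩

/-- Step (iv) of the reduction: **`Q ≤ λ² q(u,d,w)`**. [cite: Ford2002, (5.18), (5.22)] -/
theorem tail_Q_le {lam k h g s η w u d : ℝ} (hlam : 2025 ≤ lam) (hw : w = lam ^ (-(1 : ℝ) / 2))
    (hu : u = h / lam) (hd : d = (g - h) / lam)
    (hk2 : k ≤ lam * (2500 / 1623 + 3 / 1000000 * (1 / lam))) (hk0 : 0 < k)
    (hh : 1 ≤ h) (hgh : h + 2 ≤ g)
    (hs1 : 0.3299 * h * (g - h) ≤ s) (hs2 : s ≤ 0.3299 * h * (g - h) + 1)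
    (hη : η ≤ 2 / 16.3 * w ^ 3) :
    0.1905 * (0.001 * k ^ 2)
      + 0.1603 * ((g - h + 1) * (g - h) / 2 + η * s ^ 2 / (2 * (g - h + 1))
          + h * (g - h + 1) * Real.exp (-s / (h * (g - h + 1))))
      ≤ lam ^ 2 * qf u d w := by
  have hlam0 : 0 < lam := by linarith
  obtain ⟨hwlam, hw0, hhlam, hglam, hτ⟩ := tail_setup hlam hw hu hd
  have hw2 : w ^ 2 = 1 / lam := by rw [← hwlam]; field_simp
  have hu0 : 0 < u := by rw [hu]; exact div_pos (by linarith) hlam0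
  have hd0 : 0 < d := by rw [hd]; exact div_pos (by linarith) hlam0
  have hdp0 : 0 < d + w ^ 2 := by positivity
  have hh0 : 0 < h := by linarith
  have hgh0 : 0 < g - h := by linarith
  have hs0 : 0 < s := lt_of_lt_of_le (by positivity) hs1
  set A : ℝ := 3299 / 10000 * u * d + (w ^ 2) ^ 2 with hA
  set khi : ℝ := 2500 / 1623 + 3 / 1000000 * w ^ 2 with hkhi
  have hA0 : 0 < A := by positivity
  -- `k ≤ λ khi`
  have hkle : k ≤ lam * khi := by rw [hkhi, hw2]; exact hk2
  have hk2le : k ^ 2 ≤ lam ^ 2 * khi ^ 2 := by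
    rw [← mul_pow]; exact pow_le_pow_left₀ hk0.le hkle 2
  -- `λ² σud ≤ s ≤ λ² A`
  have hsle : s ≤ lam ^ 2 * A := by
    have e : lam ^ 2 * A = 0.3299 * h * (g - h) + 1 := by
      rw [hglam, hhlam, hA, show (w ^ 2) ^ 2 = (w ^ 2 * lam) ^ 2 / lam ^ 2 by field_simp, hwlam]
      field_simp; ring
    rw [e]; exact hs2
  have hsge : lam ^ 2 * (3299 / 10000 * u * d) ≤ s := by
    have e : lam ^ 2 * (3299 / 10000 * u * d) = 0.3299 * h * (g - h) := by rw [hglam, hhlam]; ring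
    rw [e]; exact hs1
  -- the exponential factor
  have hexp : Real.exp (-s / (h * (g - h + 1))) ≤ Real.exp (-(3299 / 10000 * d) / (d + w ^ 2)) := by
    refine Real.exp_le_exp.2 ?_
    rw [neg_div, neg_div, neg_le_neg_iff, div_le_div_iff₀ hdp0 (by positivity)]
    rw [hτ, hhlam]
    have : 3299 / 10000 * d * (lam * u * (lam * (d + w ^ 2))) = (lam ^ 2 * (3299 / 10000 * u * d)) * (d + w ^ 2) := by
      ring
    rw [this]
    exact mul_le_mul_of_nonneg_right hsge hdp0.le
  have hE2a : (g - h + 1) * (g - h) / 2 = lam ^ 2 * ((d + w ^ 2) * d * (1 / 2)) := by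
    rw [hτ, hglam]; ring
  have hE2b : η * s ^ 2 / (2 * (g - h + 1)) ≤ lam ^ 2 * (A ^ 2 * w / (16300 / 1000 * (d + w ^ 2))) := by
    rw [hτ, div_le_iff₀ (by positivity)]
    have hs2' : s ^ 2 ≤ (lam ^ 2 * A) ^ 2 := pow_le_pow_left₀ hs0.le hsle 2
    have h1 : η * s ^ 2 ≤ 2 / 16.3 * w ^ 3 * (lam ^ 2 * A) ^ 2 :=
      mul_le_mul hη hs2' (by positivity) (by positivity)
    have e : lam ^ 2 * (A ^ 2 * w / (16300 / 1000 * (d + w ^ 2))) * (2 * (lam * (d + w ^ 2)))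
        = 2 / 16.3 * w * lam ^ 3 * A ^ 2 := by field_simp; ring
    rw [e]
    have e2 : 2 / 16.3 * w ^ 3 * (lam ^ 2 * A) ^ 2 = 2 / 16.3 * w * lam ^ 3 * A ^ 2 * (w ^ 2 * lam) := by ring
    rw [e2, hwlam, mul_one] at h1
    exact h1
  have hE2c : h * (g - h + 1) * Real.exp (-s / (h * (g - h + 1)))
      ≤ lam ^ 2 * (u * (d + w ^ 2) * Real.exp (-(3299 / 10000 * d) / (d + w ^ 2))) := by
    have e : h * (g - h + 1) = lam ^ 2 * (u * (d + w ^ 2)) := by rw [hτ, hhlam]; ring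
    have h0 : 0 ≤ lam ^ 2 * (u * (d + w ^ 2)) := by positivity
    calc h * (g - h + 1) * Real.exp (-s / (h * (g - h + 1)))
        = lam ^ 2 * (u * (d + w ^ 2)) * Real.exp (-s / (h * (g - h + 1))) := by rw [e]
      _ ≤ lam ^ 2 * (u * (d + w ^ 2)) * Real.exp (-(3299 / 10000 * d) / (d + w ^ 2)) :=
          mul_le_mul_of_nonneg_left hexp h0
      _ = lam ^ 2 * (u * (d + w ^ 2) * Real.exp (-(3299 / 10000 * d) / (d + w ^ 2))) := by ring
  have step : 0.1905 * (0.001 * k ^ 2)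
      + 0.1603 * ((g - h + 1) * (g - h) / 2 + η * s ^ 2 / (2 * (g - h + 1))
          + h * (g - h + 1) * Real.exp (-s / (h * (g - h + 1))))
      ≤ 0.1905 * (0.001 * (lam ^ 2 * khi ^ 2))
        + 0.1603 * (lam ^ 2 * ((d + w ^ 2) * d * (1 / 2)) + lam ^ 2 * (A ^ 2 * w / (16300 / 1000 * (d + w ^ 2)))
          + lam ^ 2 * (u * (d + w ^ 2) * Real.exp (-(3299 / 10000 * d) / (d + w ^ 2)))) := by
    linarith [hk2le, hE2a, hE2b, hE2c]
  refine step.trans (le_of_eq ?_)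
  unfold qf; rw [← hkhi, ← hA]; ring

/-- Step (iii) of the reduction: **`2rs ≤ λ⁴ den(u,d,w)`**. [cite: Ford2002, (5.21)] -/
theorem tail_den_le {lam k r h g s w u d : ℝ} (hlam : 2025 ≤ lam) (hw : w = lam ^ (-(1 : ℝ) / 2))
    (hu : u = h / lam) (hd : d = (g - h) / lam)
    (hk2 : k ≤ lam * (2500 / 1623 + 3 / 1000000 * (1 / lam))) (hk0 : 0 < k)
    (hr2 : r ≤ 3.21432 * k ^ 2 + 1) (hh : 1 ≤ h) (hgh : h + 2 ≤ g)
    (hs0 : 0 < s) (hs2 : s ≤ 0.3299 * h * (g - h) + 1) :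
    2 * r * s ≤ lam ^ 4 * denf u d w := by
  have hlam0 : 0 < lam := by linarith
  obtain ⟨hwlam, hw0, hhlam, hglam, _⟩ := tail_setup hlam hw hu hd
  have hw2 : w ^ 2 = 1 / lam := by rw [← hwlam]; field_simp
  have hu0 : 0 < u := by rw [hu]; exact div_pos (by linarith) hlam0
  have hd0 : 0 < d := by rw [hd]; exact div_pos (by linarith) hlam0
  set A : ℝ := 3299 / 10000 * u * d + (w ^ 2) ^ 2 with hA
  set khi : ℝ := 2500 / 1623 + 3 / 1000000 * w ^ 2 with hkhi
  have hkle : k ≤ lam * khi := by rw [hkhi, hw2]; exact hk2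
  have hk2le : k ^ 2 ≤ lam ^ 2 * khi ^ 2 := by
    rw [← mul_pow]; exact pow_le_pow_left₀ hk0.le hkle 2
  have hsle : s ≤ lam ^ 2 * A := by
    have e : lam ^ 2 * A = 0.3299 * h * (g - h) + 1 := by
      rw [hglam, hhlam, hA, show (w ^ 2) ^ 2 = (w ^ 2 * lam) ^ 2 / lam ^ 2 by field_simp, hwlam]
      field_simp; ring
    rw [e]; exact hs2
  have hr' : r ≤ lam ^ 2 * (321432 / 100000 * khi ^ 2 + (w ^ 2) ^ 2) := by
    have e : lam ^ 2 * (321432 / 100000 * khi ^ 2 + (w ^ 2) ^ 2) = 3.21432 * (lam ^ 2 * khi ^ 2) + 1 := by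
      rw [show (w ^ 2) ^ 2 = (w ^ 2 * lam) ^ 2 / lam ^ 2 by field_simp, hwlam]; field_simp; ring
    rw [e]; linarith
  have e2 : lam ^ 4 * denf u d w = 2 * (lam ^ 2 * (321432 / 100000 * khi ^ 2 + (w ^ 2) ^ 2)) * (lam ^ 2 * A) := by
    unfold denf; rw [← hkhi, ← hA]; ring
  rw [e2]
  have h1 : 2 * r * s ≤ 2 * (lam ^ 2 * (321432 / 100000 * khi ^ 2 + (w ^ 2) ^ 2)) * s := by
    have := mul_le_mul_of_nonneg_right hr' hs0.le
    linarith
  refine h1.trans ?_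
  exact mul_le_mul_of_nonneg_left hsle (by positivity)

/-- **The analytic reduction of the exponent condition at one `λ ≥ 2025`.** With `ν = 1/λ`,
`w = λ^{-1/2}`, `u = h/λ`, `d = (g−h)/λ` and the floors controlled by the hypotheses, the quantity
`λ²·(c9)` of `FordVK.sec5_interval` is at most `10⁻⁷ + n(u,d,w)/den(u,d,w) + 1/133.66`.
[cite: Ford2002, (5.22) and proof of Lemma 5.2] -/
theorem c9_reduction {lam k r h g s B η : ℝ} (hlam : 2025 ≤ lam)
    (hk1 : lam * (2500 / 1623 - 1 / lam) ≤ k) (hk2 : k ≤ lam * (2500 / 1623 + 3 / 1000000 * (1 / lam)))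
    (hr1 : 3.21432 * k ^ 2 ≤ r) (hr2 : r ≤ 3.21432 * k ^ 2 + 1)
    (hh : 1 ≤ h) (hgh : h + 2 ≤ g)
    (hs1 : 0.3299 * h * (g - h) ≤ s) (hs2 : s ≤ 0.3299 * h * (g - h) + 1)
    (hη : η ≤ 2 / 16.3 * (lam ^ (-(1 : ℝ) / 2)) ^ 3) (hB1 : B ≤ 4123 / 20000)
    (hn : nf (h / lam) ((g - h) / lam) (lam ^ (-(1 : ℝ) / 2)) < 0)
    (hF : nf (h / lam) ((g - h) / lam) (lam ^ (-(1 : ℝ) / 2))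
        / denf (h / lam) ((g - h) / lam) (lam ^ (-(1 : ℝ) / 2)) + 1 / 10000000 + 50 / 6683 ≤ 0) :
    Real.log (300 * lam ^ 2) / (300 * lam ^ 2) / r
      + (0.1905 * (0.001 * k ^ 2)
          + 0.1603 * ((g - h + 1) * (g - h) / 2 + η * s ^ 2 / (2 * (g - h + 1))
              + h * (g - h + 1) * Real.exp (-s / (h * (g - h + 1))))
          - (lam ^ 2 * H2f (h / lam) ((g - h) / lam) + lam * H1f (h / lam) ((g - h) / lam) - B))
        / (2 * r * s)
      + 1 / (133.66 * lam ^ 2) ≤ 0 := by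
  have hlam0 : 0 < lam := by linarith
  obtain ⟨w, hw⟩ : ∃ x : ℝ, x = lam ^ (-(1 : ℝ) / 2) := ⟨_, rfl⟩
  obtain ⟨u, hu⟩ : ∃ x : ℝ, x = h / lam := ⟨_, rfl⟩
  obtain ⟨d, hd⟩ : ∃ x : ℝ, x = (g - h) / lam := ⟨_, rfl⟩
  rw [← hw] at hη
  rw [← hw, ← hu, ← hd] at hn hF
  rw [← hu, ← hd]
  obtain ⟨hwlam, hw0, _, _, _⟩ := tail_setup hlam hw hu hd
  have hgh0 : 0 < g - h := by linarith
  have hh0 : 0 < h := by linarith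
  have hs0 : 0 < s := lt_of_lt_of_le (by positivity) hs1
  have hk0 : 0 < k := by
    have : 0 < lam * (2500 / 1623 - 1 / lam) := by
      rw [mul_sub, mul_one_div_cancel hlam0.ne']; nlinarith
    linarith
  have hr0 : 0 < r := lt_of_lt_of_le (by positivity) hr1
  have hrs0 : 0 < 2 * r * s := by positivity
  have hQ := tail_Q_le hlam hw hu hd hk2 hk0 hh hgh hs1 hs2 hη
  have hden := tail_den_le hlam hw hu hd hk2 hk0 hr2 hh hgh hs0 hs2
  -- (v) the `H` part
  have hH : lam ^ 2 * (H2f u d + w ^ 2 * H1f u d - 4123 / 20000 * (w ^ 2) ^ 2)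
      ≤ lam ^ 2 * H2f u d + lam * H1f u d - B := by
    have e1 : lam ^ 2 * (w ^ 2 * H1f u d) = lam * H1f u d := by
      rw [show lam ^ 2 * (w ^ 2 * H1f u d) = lam * (w ^ 2 * lam) * H1f u d by ring, hwlam, mul_one]
    have e2 : lam ^ 2 * (4123 / 20000 * (w ^ 2) ^ 2) = 4123 / 20000 := by
      rw [show lam ^ 2 * (4123 / 20000 * (w ^ 2) ^ 2) = 4123 / 20000 * (w ^ 2 * lam) ^ 2 by ring, hwlam]; ring
    have e3 : lam ^ 2 * (H2f u d + w ^ 2 * H1f u d - 4123 / 20000 * (w ^ 2) ^ 2)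
        = lam ^ 2 * H2f u d + lam * H1f u d - 4123 / 20000 := by
      rw [mul_sub, mul_add, e1, e2]
    linarith [e3, hB1]
  -- (vi) numerator `≤ λ² nf < 0`
  have hnum : 0.1905 * (0.001 * k ^ 2)
      + 0.1603 * ((g - h + 1) * (g - h) / 2 + η * s ^ 2 / (2 * (g - h + 1))
          + h * (g - h + 1) * Real.exp (-s / (h * (g - h + 1))))
      - (lam ^ 2 * H2f u d + lam * H1f u d - B) ≤ lam ^ 2 * nf u d w := by
    have e : lam ^ 2 * nf u d w = lam ^ 2 * qf u d w
        - lam ^ 2 * (H2f u d + w ^ 2 * H1f u d - 4123 / 20000 * (w ^ 2) ^ 2) := by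
      unfold nf; ring
    linarith [hQ, hH, e]
  have hnf0 : lam ^ 2 * nf u d w < 0 := mul_neg_of_pos_of_neg (by positivity) hn
  -- (vii) the main quotient
  have hmain : lam ^ 2 * ((0.1905 * (0.001 * k ^ 2)
      + 0.1603 * ((g - h + 1) * (g - h) / 2 + η * s ^ 2 / (2 * (g - h + 1))
          + h * (g - h + 1) * Real.exp (-s / (h * (g - h + 1))))
      - (lam ^ 2 * H2f u d + lam * H1f u d - B)) / (2 * r * s)) ≤ nf u d w / denf u d w := by
    have hden0 : 0 < lam ^ 4 * denf u d w := lt_of_lt_of_le hrs0 hden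
    have h1 : lam ^ 2 * ((0.1905 * (0.001 * k ^ 2)
        + 0.1603 * ((g - h + 1) * (g - h) / 2 + η * s ^ 2 / (2 * (g - h + 1))
            + h * (g - h + 1) * Real.exp (-s / (h * (g - h + 1))))
        - (lam ^ 2 * H2f u d + lam * H1f u d - B)) / (2 * r * s))
        ≤ lam ^ 2 * (lam ^ 2 * nf u d w / (2 * r * s)) :=
      mul_le_mul_of_nonneg_left (div_le_div_of_nonneg_right hnum hrs0.le) (by positivity)
    have h2 : lam ^ 2 * nf u d w / (2 * r * s) ≤ lam ^ 2 * nf u d w / (lam ^ 4 * denf u d w) := by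
      rw [div_eq_mul_one_div (lam ^ 2 * nf u d w) (2 * r * s), div_eq_mul_one_div (lam ^ 2 * nf u d w)]
      exact mul_le_mul_of_nonpos_left (one_div_le_one_div_of_le hrs0 hden) hnf0.le
    have e3 : lam ^ 2 * (lam ^ 2 * nf u d w / (lam ^ 4 * denf u d w)) = nf u d w / denf u d w := by
      have hden1 : denf u d w ≠ 0 := by
        intro h0; rw [h0, mul_zero] at hden0; exact lt_irrefl _ hden0
      field_simp
    calc _ ≤ lam ^ 2 * (lam ^ 2 * nf u d w / (2 * r * s)) := h1
      _ ≤ lam ^ 2 * (lam ^ 2 * nf u d w / (lam ^ 4 * denf u d w)) :=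
          mul_le_mul_of_nonneg_left h2 (by positivity)
      _ = nf u d w / denf u d w := e3
  -- (viii) the `E₃` term
  have hE3 : lam ^ 2 * (Real.log (300 * lam ^ 2) / (300 * lam ^ 2) / r) ≤ 1 / 10000000 := by
    refine E3_term_le hlam (le_trans ?_ hr1)
    have hk' : 1.5398 * lam ≤ k := by
      have e : lam * (2500 / 1623 - 1 / lam) = 2500 / 1623 * lam - 1 := by field_simp
      rw [e] at hk1; linarith
    have h0 : 0 ≤ 1.5398 * lam := by positivity
    have := pow_le_pow_left₀ h0 hk' 2
    linarith
  -- (ix) assemble: multiply the goal by `λ² > 0`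
  have key : lam ^ 2 * (Real.log (300 * lam ^ 2) / (300 * lam ^ 2) / r
      + (0.1905 * (0.001 * k ^ 2)
          + 0.1603 * ((g - h + 1) * (g - h) / 2 + η * s ^ 2 / (2 * (g - h + 1))
              + h * (g - h + 1) * Real.exp (-s / (h * (g - h + 1))))
          - (lam ^ 2 * H2f u d + lam * H1f u d - B)) / (2 * r * s)
      + 1 / (133.66 * lam ^ 2)) ≤ 0 := by
    have e : lam ^ 2 * (1 / (133.66 * lam ^ 2)) = 50 / 6683 := by field_simp; norm_num
    rw [mul_add, mul_add, e]
    linarith [hE3, hmain, hF]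
  by_contra hcon
  push Not at hcon
  have : 0 < lam ^ 2 * _ := mul_pos (by positivity) hcon
  linarith

end Tail
end FordVK
end Literature.NumberTheory.LFunctions
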